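import Summits.ABC.IUTFork.Joshi.LogVolumesHullsLocus
import Literature.IUT.LogVolume.PadicBoxVolume
import Mathlib.NumberTheory.Padics.RingHoms
import Mathlib.Analysis.Normed.Unbundled.RingSeminorm

/-!
# A genuine `ℚ_p` model of Joshi's §9.10 volume signature — `Vol_{ℚ_p}` IS [AbsTopIII] Prop. 5.7 (i)'s `μ_k`

K. Joshi, *Construction of Arithmetic Teichmüller Spaces III* (arXiv:2401.13508 **v4**, unrefereed; bib
`Joshi2024ATS3`), §9.10.2, p.122 l.32 – p.123 l.38. Cell abc-iut, block E (rung LADDER-ABC:A2.E), seat E-t23 (slot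
T-23), fallback §4 (1)/(3) in own lane: NON-VACUITY of the typed §9.10 chain, and one more DICTIONARY row.
The signature `LogVol.VolumeDatum` (p428811) records Joshi's «unique normalized translation invariant … Haar measure …
Vol(𝒪) = 1» (p.122 l.37–46) and «Vol(π𝒪) = |π| … by translation invariance of the Haar measure (or otherwise)» (p.123
l.11–15) / Lem. 9.10.2.2 (2) «clear from the definition of Vol_E» as FIELDS. For `E = ℚ_p` all of them are THEOREMS
of the tree's Literature layer: Joshi's `Vol_{ℚ_p}` is, by definition here, S. Mochizuki's volume `μ_k` of [AbsTopIII]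
Prop. 5.7 (i) (`Literature.IUT.LogVolume.localVolume ℚ_[p]`, campaign-S files `LocalFieldVolume` /
`PadicBoxVolume`: normalisation `localVolume_closedBall_one`, translation invariance `localVolume_vadd`, and the
module `μ(c·ℤ_p) = ‖c‖_p` = `localVolume_padic_closedBall_norm` / `distribHaarChar_padic_eq_nnnorm`, Weil *BNT* I §2),
with `𝒪 = ℤ_p` (`PadicInt.subring`) and `|−| = ‖−‖_p`. Hence `padicVolumeDatum p : VolumeDatum ℚ_[p]` with NO property
field left as a hypothesis, and a one-factor, one-label `ExhibitedDatum` over `ℚ_p` whose projection `toLocusDatum`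
is a `p`-ADIC instance of E-t4's `ATS3.LocusDatum 1` at which (9.9.4), `HullVolumeLowerBound` (by p429037), Thm.
9.11.1 (at the place) and the sign convention are EVALUATED — the typed §9.9–§9.11 chain is inhabited over a genuine
`p`-adic field. The σ-algebra on `ℚ_[p]` is a binder (`[MeasurableSpace ℚ_[p]] [BorelSpace ℚ_[p]]`, as in the
Literature files); no instance is declared. FRAMING: standard mathematics; nothing of Joshi's is asserted; no side
taken on [IUTchIII] Cor. 3.12 or on any author.
-/

noncomputable section

namespace Summit.ABC.IUTFork.Joshi.LogVol

open MeasureTheory Metric Literature.IUT.LogVolume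
open scoped NNReal ENNReal Pointwise

variable (p : ℕ) [Fact p.Prime]

/-- `PadicInt.subring p` (Mathlib's `ℤ_p ⊂ ℚ_p`) is the closed unit ball as a set. [folklore] -/
theorem coe_subring_eq_closedBall : ((PadicInt.subring p : Subring ℚ_[p]) : Set ℚ_[p]) = closedBall 0 1 := by
  ext x; simp [PadicInt.mem_subring_iff]

/-- `λ·ℤ_p` is the closed ball of radius `‖λ‖_p` (`λ ≠ 0`). [folklore] -/
theorem image_mul_unitBall {l : ℚ_[p]} (hl : l ≠ 0) :
    (fun x => l * x) '' closedBall (0 : ℚ_[p]) 1 = closedBall 0 ‖l‖ := by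
  ext y
  simp only [Set.mem_image, mem_closedBall, dist_zero_right]
  constructor
  · rintro ⟨x, hx, rfl⟩
    rw [norm_mul]; exact mul_le_of_le_one_right (norm_nonneg l) hx
  · intro hy
    refine ⟨l⁻¹ * y, ?_, by rw [← mul_assoc, mul_inv_cancel₀ hl, one_mul]⟩
    rw [norm_mul, norm_inv, inv_mul_le_iff₀ (norm_pos_iff.2 hl), mul_one]
    exact hy

variable [MeasurableSpace ℚ_[p]] [BorelSpace ℚ_[p]]

/-- **`μ(λ·ℤ_p) = ‖λ‖_p`** (`λ ≠ 0`) for Mochizuki's volume `μ_{ℚ_p}` — the Literature theorem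
`localVolume_padic_closedBall_norm` in image form. [cite: WeilBNT1967, Ch. I §2, Cor. 2 of Th. 3] -/
theorem localVolume_image_mul_unitBall {l : ℚ_[p]} (hl : l ≠ 0) :
    localVolume ℚ_[p] ((fun x => l * x) '' closedBall (0 : ℚ_[p]) 1) = ENNReal.ofReal ‖l‖ := by
  rw [image_mul_unitBall p hl]
  have h := localVolume_padic_closedBall_norm p (Units.mk0 l hl)
  rw [Units.val_mk0] at h
  rw [h, ENNReal.ofReal_eq_coe_nnreal (norm_nonneg l)]
  rfl

/-- **`ℚ_p` as a `VolumeDatum`** (Joshi §9.10.2 for `E = ℚ_p`): `Vol` := Mochizuki's `μ_{ℚ_p}` ([AbsTopIII] Prop. 5.7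
(i), `Literature.IUT.LogVolume.localVolume`), `𝒪 = ℤ_p`, `|−| = ‖−‖_p`; ALL four property fields of the §9.10.2
signature — `Vol(𝒪) = 1`, translation invariance, `Vol(λ𝒪) = |λ|` (Lem. 9.10.2.2 (2)), `|𝒪| ≤ 1` — are PROVED, the
third being the module computation of Weil *BNT* I §2. [folklore] -/
def padicVolumeDatum : VolumeDatum ℚ_[p] where
  vol := localVolume ℚ_[p]
  O := PadicInt.subring p
  abs := NormedField.toAbsoluteValue ℚ_[p]
  vol_O := by rw [coe_subring_eq_closedBall]; exact localVolume_closedBall_one ℚ_[p]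
  vol_translate := fun a S => by
    rw [show (fun x => a + x) '' S = a +ᵥ S from Set.image_vadd (a := a) (t := S)]; exact localVolume_vadd ℚ_[p] a S
  vol_mulBall := fun l hl => by rw [coe_subring_eq_closedBall]; exact localVolume_image_mul_unitBall p hl
  abs_le_one := fun x hx => (PadicInt.mem_subring_iff p).1 hx

/-- **DICTIONARY, PROVED (`rfl`)**: Joshi's `Vol_{ℚ_p}` (§9.10.2) IS Mochizuki's volume `μ_{ℚ_p}` of [AbsTopIII]
Prop. 5.7 (i) as typed in the tree (`Literature.IUT.LogVolume.localVolume ℚ_[p]`) — the local log-volume both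
[IUTchIII] Prop. 3.9 and Joshi's §9.10 start from. [folklore] -/
theorem padicVolumeDatum_vol : (padicVolumeDatum p).vol = localVolume ℚ_[p] := rfl

/-- The absolute value of the `ℚ_p` datum is the `p`-adic norm. [folklore] -/
theorem padicVolumeDatum_abs (x : ℚ_[p]) : (padicVolumeDatum p).abs x = ‖x‖ := rfl

/-- Lem. 9.10.2.2 (2) at `ℚ_p` through the signature: `Vol(α + λℤ_p) = ‖λ‖_p`. [folklore] -/
theorem padicVolumeDatum_vol_ball (α : ℚ_[p]) {l : ℚ_[p]} (hl : l ≠ 0) :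
    (padicVolumeDatum p).vol ((padicVolumeDatum p).ball α l) = ENNReal.ofReal ‖l‖ :=
  (padicVolumeDatum p).vol_ball α hl

/-- Joshi's `LogVol(λℤ_p) = log ‖λ‖_p` at `ℚ_p` (p.123 l.17–22), now unconditional. [folklore] -/
theorem padicVolumeDatum_logVol_ball (α : ℚ_[p]) {l : ℚ_[p]} (hl : l ≠ 0) :
    (padicVolumeDatum p).logVol ((padicVolumeDatum p).ball α l) = (Real.log ‖l‖ : EReal) :=
  (padicVolumeDatum p).logVol_ball α hl

/-- **Non-vacuity of the exhibited-element chain over `ℚ_p`** (one factor, one label `ℓ* = 1`, ambient space `ℚ_p`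
itself, the ball-tensor = the ball, hull operator = identity, the locus = the exhibited ball `τ·ℤ_p` with `τ := p`,
`|q^{1/2ℓ}| := p⁻¹`): an `ExhibitedDatum` over `ℚ_p` all of whose signature fields are THEOREMS. [folklore] -/
def padicExhibitedDatum : ExhibitedDatum 1 (fun _ => ℚ_[p]) ℚ_[p] where
  D := fun _ => padicVolumeDatum p
  Γ := ⟨fun _ => 1, fun _ => one_pos, fun _ => le_rfl⟩
  vol := localVolume ℚ_[p]
  tens := fun V => V 0
  vol_tens := fun α l hl => by
    have hfin : (padicVolumeDatum p).vol ((padicVolumeDatum p).ball (α 0) (l 0)) ≠ ⊤ := by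
      rw [padicVolumeDatum_vol_ball p (α 0) (hl 0)]; exact ENNReal.ofReal_ne_top
    change (padicVolumeDatum p).vol _ = _
    rw [weightedVol, Fin.prod_univ_one, Real.rpow_one, ENNReal.ofReal_toReal hfin]
  hull := id
  subset_hull := fun _ => le_rfl
  hull_mono := fun _ _ h => h
  qroot := (p : ℝ)⁻¹
  qroot_pos := inv_pos.2 (by exact_mod_cast (Fact.out : p.Prime).pos)
  qroot_lt_one := inv_lt_one_of_one_lt₀ (by exact_mod_cast (Fact.out : p.Prime).one_lt)
  τ := fun _ => (p : ℚ_[p])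
  τ_mem := fun _ => (PadicInt.mem_subring_iff p).2 (Padic.norm_p_lt_one).le
  τ_ne := fun _ => by exact_mod_cast (Fact.out : p.Prime).ne_zero
  locus := (padicVolumeDatum p).ball 0 (p : ℚ_[p])
  tens_subset_locus := le_rfl
  vol_hull_ne_top := by
    change (padicVolumeDatum p).vol ((padicVolumeDatum p).ball 0 (p : ℚ_[p])) ≠ ⊤
    rw [padicVolumeDatum_vol_ball p 0 (by exact_mod_cast (Fact.out : p.Prime).ne_zero)]
    exact ENNReal.ofReal_ne_top
  supNorm := (p : ℝ)⁻¹

/-- The hull volume of the `ℚ_p` instance, read on E-t4's carrier, is `μ(p·ℤ_p) = p⁻¹` — a Haar-measure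
COMPUTATION, not a hypothesis. [folklore] -/
theorem padicExhibitedDatum_hullVol : (padicExhibitedDatum p).toLocusDatum.hullVol = (p : ℝ)⁻¹ := by
  change ((padicVolumeDatum p).vol ((padicVolumeDatum p).ball 0 (p : ℚ_[p]))).toReal = _
  rw [padicVolumeDatum_vol_ball p 0 (by exact_mod_cast (Fact.out : p.Prime).ne_zero),
    ENNReal.toReal_ofReal (norm_nonneg _), Padic.norm_p]

/-- At the `ℚ_p` instance E-t4's reading predicates are EVALUATED: (9.9.4) `ValuationScaling` holds (`|τ| =
|q^{1/2ℓ}| = p⁻¹`, one label), `HullVolumeLowerBound` holds (p429037, from the typed Lem. 9.10.7.1), hence Thm.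
9.11.1 at this place, and the sign convention `Vol ≤ 1`. Non-vacuity witness for the typed §9.9–§9.11 chain over a
genuine `p`-adic field. [folklore] -/
theorem padicExhibitedDatum_profile :
    (padicExhibitedDatum p).toLocusDatum.ValuationScaling ∧ (padicExhibitedDatum p).toLocusDatum.HullVolumeLowerBound ∧
      (padicExhibitedDatum p).toLocusDatum.FundamentalEstimateVol ∧ (padicExhibitedDatum p).toLocusDatum.LogVolNonpos := by
  have hV : (padicExhibitedDatum p).toLocusDatum.ValuationScaling := by
    intro i
    change (padicVolumeDatum p).abs (p : ℚ_[p]) = ((p : ℝ)⁻¹) ^ ATS3.LocusDatum.scalingExponent 1 i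
    rw [padicVolumeDatum_abs, Padic.norm_p, ATS3.LocusDatum.scalingExponent, Fin.val_eq_zero i]
    norm_num
  refine ⟨hV, (padicExhibitedDatum p).hullVolumeLowerBound_toLocusDatum,
    (padicExhibitedDatum p).fundamentalEstimateVol_of_valuationScaling hV, ?_⟩
  change (padicExhibitedDatum p).toLocusDatum.hullVol ≤ 1
  rw [padicExhibitedDatum_hullVol]
  exact inv_le_one_of_one_le₀ (by exact_mod_cast (Fact.out : p.Prime).one_le)

end Summit.ABC.IUTFork.Joshi.LogVol

end
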